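import Summits.HodgeConjecture.HodgeConjecture.Theorems.F0P3cDbTSupercuspidalOffOccurringClass   -- ★ (SCᴸ) p848292 (LH10-p01): `X_v(μ,a,χ_f)` supercuspidal OFF the occurring class
import Summits.HodgeConjecture.HodgeConjecture.Theorems.F0P2oK1occ                                -- ★ `exists_units_not_isNorm_of_nonsplit` (a global non-norm at a non-split `v`)
import Summits.HodgeConjecture.HodgeConjecture.Theorems.F0P2sOccFlatAllOfThetaOccursIn            -- ★ OCC♭∀ ⟸ Θ-OCC-GEN
import Summits.HodgeConjecture.HodgeConjecture.Theorems.F0P2tThetaOccursInGenNeg                  -- ★ Θ-OCC-GEN `thetaOccursInGen` (hypothesis-free)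
import Summits.HodgeConjecture.HodgeConjecture.Theorems.F0P2uS2SharpTheta                         -- ★ S2♯-θ `memXiFamily_of_theta_of_clauses` (+ ★ FILE 2)
import Summits.HodgeConjecture.HodgeConjecture.Theorems.F0P3cDbTThetaConstituents                 -- ★ (TCᴸ) p848434 (this seat)
import Literature.AlgebraicGeometry.Liu2021.AdmissibleElementPrescribedLocalClass                 -- ★ (WAᴸ-2) p848354 (this seat): admissible `a·δ` with `a` in a prescribed square class
import Literature.NumberTheory.Automorphic.HeckeCharacterSemilocalRigidity                        -- ★ (c) p848293 (LH1-p04): Hecke characters are pinned by (semi)local components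
import Literature.NumberTheory.Automorphic.AdelicUnitaryGroupMeasure                              -- ★ `exists_isAutomorphicMeasure_adelicGroupData` (ED. 2)
import Summits.HodgeConjecture.HodgeConjecture.Theorems.F0P3ClassTokensOfRecord                   -- ★ `anisotropic_of_frame` (ED. 2)
import HarnessLib

/-!
# Crux `H413`, line LH10 «(D-b)ᵀ» — (O1) PAID ON THE LIU LOCUS: theta occurrence with a prescribed supercuspidal class at `v`, for weight-one `μ` and automorphic `χ`,
# at a Rogawski frame; hence `StubThetaLiftMember`'s conclusion there

Cell `hodgecm-mathlib` (D-0151), FLOOR 0, crux item H413 = `stmt-HodgeConjecture-24833`; squad F0∕P3c line LH10 (leaf `Cruxes/H413/Lines/F0_P3c_DbTPaydown.lean` ED. 3,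
organ (O1) `StubThetaLiftMember` :88–:118), seat LH10-p02 (g0), item (N1) of this seat's 03:18Z KNOCK.  THEOREMS ONLY (no `def`, no instance, no notation, no named fact,
no `sorry`); no `Cruxes/**` import; `--supports stmt-HodgeConjecture-24833`.  HONEST LABEL: HC_CM is proved only modulo the printed citations until rung 0 closes; this file
proves no letter of the books — it pays the organ (O1) of the LH10 leaf ON THE LIU LOCUS ONLY (see below), hypothesis-free there.

THE LIU LOCUS (this seat's census «AUTOMORPHY GAP», F0∕P3c∕LH10 bus 2026-09-02T02:52Z ∕ 03:2xZ): the organ (O1) quantifies over ALL dictionary-tied pairs `(μ, χ_f)` of the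
letter (D-b)ᵀˢ; the tree's theta engine (★ Θ-OCC-GEN `F0P2tThetaOccursInGenNeg.thetaOccursInGen`, ★ S2♯-θ) speaks only for `μ` OF WEIGHT ONE (`HasWeight L μ 1`), `χ_f = χ.1` for an
AUTOMORPHIC `χ : Chi` (trivial on rational norm-one units — for the letter's general `ξ` this holds iff `(ψ̃⁻¹(η̃⁻¹ψ̃⁻¹μω)²)_∞ = 1`), at a ROGAWSKI FRAME of `H` (signature `(2,1)` at
`ι`, definite elsewhere, `[L⁺:ℚ] ≥ 2` — where the cohomological cotangent forms live).  On that locus everything is in-house: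

* §1 `exists_admissibleLine_isSupercuspidal_xThetaCM` — frame-free: for `(e₁, dV)`, conjugate-symplectic `μ`, continuous unitary `χ_f`, a set `Φ` of complex embeddings with
  no conjugate pair, a purely imaginary `δ ≠ 0` and a NON-SPLIT `v`, there is a GLOBAL line `a ∈ (L⁺)ˣ` with `a·δ` `Φ`-ADMISSIBLE [Liu2021 Def. 4.12] AND `X_v(μ, a, χ_f)`
  SUPERCUSPIDAL: ★ (SCᴸ) gives the occurring class `ε₀` off which `X_v` is supercuspidal, ★ `exists_units_not_isNorm_of_nonsplit` a global non-norm `θ` at `v`, ★ (WAᴸ-2) an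
  admissible `a` in the SQUARE CLASS of `θ·ε₀` at `v`; then `a·ε₀⁻¹ = θ·s²` is a non-norm at `v` (★ `toLocalRing_coe`, ★ `conjLocal_toLocalRing`).
* §2 `exists_hasFinComponent_isSupercuspidal_liuLocus` — at a Rogawski frame `(L, ι, H, T)` with a diagonal frame `(e₁, dV, g, ιV)`, for EVERY automorphic measure, weight-one
  `μ` and `χ : Chi`: a line `a` and a DISCRETE automorphic `P` with `P_f ↩ ω_H(μ, a, χ)` (★ OCC♭∀ `F0P2sOccFlatAllOfThetaOccursIn.stubOccFlatAll_of_thetaOccursInGen` ∘ ★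
  Θ-OCC-GEN, the admissibility witness `a·(2i)⁻¹` by §1 + ★ `epsOf_algebraMap_mul`) such that `X_v(μ, a, χ.1)` is supercuspidal.  = [GelbartRogawski1991 Prop. 3.4.1 (2)]
  («the closure of `Θ(γ,ψ,χ)` generates a non-zero automorphic representation») for `U(H)` in Liu's corner, with the line in the class of `πˢ(ξ_v)`.
* §3 `globalPins_of_dict` — DICT1 (semilocal at every finite `v`) and DICT2 (finite idèles) for an AUTOMORPHIC `χ` with `χ.1 = χ_f` give the two GLOBAL pins
  `μ̃ = η̃⁻¹ψ̃⁻¹μω`, `χ̌ = ψ̃⁻¹(η̃⁻¹ψ̃⁻¹μω)²` (★ `HeckeCharacter.eq_of_forall_semilocalComponent_eq` ∕ `ext_of_forall_localComponent_eq`: `L^×` is dense in `L_∞^×`;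
  ★ `localComponent_checkOfChi_apply`).
* §4′ (ED. 2) `stubThetaLiftMember_liuLocus'` — the same, MEASURE-FREE: the automorphic measure is produced from the frame (★ `anisotropic_of_frame`,
  ★ `exists_isAutomorphicMeasure_adelicGroupData`) — the closer of the ROAD-W organ `StubThetaLiftMemberW1`.
* §4 **`stubThetaLiftMember_liuLocus`** — the CONCLUSION of (O1) (`∃ ε μA P, MemXiFamily P … ξ ∧ (∃ v-constituent) ∧ ∀ v-constituents, supercuspidal ∧ theta type
  X_v(μ, ε, χ_f) ∘ κ_v⁻¹`) for every (O1) binder tuple ON THE LIU LOCUS — extra hypotheses: the Rogawski frame `(ι, T, hT, hdef, h2)`, an automorphic measure `μA`,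
  `HasWeight L μ 1`, `χ : Chi` with `χ.1 = χ_f` — by §2 + §3 + ★ the (O1-RED) peel's engine (★ `F0P2uS2SharpTheta.memXiFamily_of_theta_of_clauses` over ★ FILE 2, ★ (TCᴸ)).

## References
* [GelbartRogawski1991] S. Gelbart, J. Rogawski, Invent. Math. 105 (1991): §3.4 Prop. 3.4.1 pp. 459–460, Thm. 3.4 (a) p. 461; §5.1 (5.1.1) p. 465, Lem. 5.1.2 p. 466.
* [Rogawski1990] J. Rogawski, Ann. of Math. Stud. 123 (1990): §13.1 Prop. 13.1.3 (d) p. 199; §12.2 (2) p. 174; §14.6 pp. 242–245.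
* [Liu2021] Y. Liu, Camb. J. Math. 9 (2021): Def. 4.11 (l. 2090–2096), Def. 4.12 (l. 2102–2108), Prop. 4.13 (l. 2145–2149); App. D §D.1 (l. 5224), Lem. D.1 (1).
* [Omeara1963] O. T. O'Meara, *Introduction to quadratic forms* (1963), §63A Cor. 63:1b, §63B, §65 Prop. 65:21.  [CasselsFrohlichANT1967] Ch. II §6; Ch. VII Prop. 4.1.
-/

set_option autoImplicit false
-- the mandated namespace repeats the single-problem summit's segment (`HodgeConjecture.HodgeConjecture`)
set_option linter.dupNamespace false

noncomputable section

open scoped Matrix Kronecker MatrixGroups MonoidAlgebra ComplexOrder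
open NumberField NumberField.InfinitePlace IsDedekindDomain MeasureTheory
open Literature.NumberTheory Literature.NumberTheory.Automorphic Literature.NumberTheory.Automorphic.UnitaryGroup
open Literature.NumberTheory.Automorphic.Liu2021 Literature.NumberTheory.Automorphic.Liu2021.AppendixC
open Literature.NumberTheory.Automorphic.Liu2021.Def411WeilCarriers
open Literature.NumberTheory.Automorphic.Liu2021.Def411WeilCarriersDoubling
open Literature.NumberTheory.Automorphic.Liu2021.CheckOfChi
open Literature.NumberTheory.Automorphic.IdeleClassGroup
open Literature.NumberTheory.GelbartRogawski1991 Literature.NumberTheory.GelbartRogawski1991.UnitaryDualPair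
open Literature.NumberTheory.GelbartRogawski1991.UnitaryDualPair.WeilCoinv
open Literature.NumberTheory.GelbartRogawski1991.UnitaryDualPair.LocalSplitting
open Literature.RepresentationTheory Literature.RepresentationTheory.Liu2021
open Literature.NumberTheory.GaloisRepresentations Literature.RepresentationTheory.HarrisKudlaSweet1996
open Literature.NumberTheory.Rogawski1990
open Literature.AlgebraicGeometry.Liu2021 (IsAdmissibleElement)
open Summit.HodgeConjecture.CorCM
open Summit.HodgeConjecture.CorCM.Transposition
open Summit.HodgeConjecture.HodgeConjecture.Cruxes.H413

namespace Summit.HodgeConjecture.HodgeConjecture.Cruxes.H413.F0P3cDbTThetaOccurrenceLiuLocus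

/-! ## §1 A global ADMISSIBLE line in the SUPERCUSPIDAL class at a non-split place (frame-free) -/

section Line

variable (L : Type) [Field L] [NumberField L] [IsCMField L] {n' : ℕ} (e₁ : Fin 3 × Fin 1 ≃ Fin n') (dV : Fin 3 → L)
    (hdV : ∀ i, IsCMField.complexConj L (dV i) = dV i) (hdV0 : ∀ i, dV i ≠ 0)
    (μ : Literature.NumberTheory.Automorphic.IdeleClassGroup L →ₜ* Circle) (hμ : IsConjugateSymplectic L μ)
    (χf : UnitaryGroup.finAdelicOne (↥(maximalRealSubfield L)) L (IsCMField.complexConj L) →* ℂˣ)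
    (hcont : Continuous χf) (hunit : ∀ z, ‖((χf z : ℂˣ) : ℂ)‖ = 1)

include hcont hunit

set_option synthInstance.maxHeartbeats 400000 in
set_option maxHeartbeats 16000000 in
/-- **A GLOBAL LINE `a ∈ (L⁺)ˣ` WITH `a·δ` ADMISSIBLE AND `X_v(μ, a, χ_f)` SUPERCUSPIDAL** at a non-split finite place `v`: for a set `Φ` of complex embeddings of `L` without
conjugate pairs (every CM type `Φ_μ`) and a purely imaginary `δ ≠ 0`.  The occurring class `ε₀` at `v` (★ (SCᴸ): off it `X_v` is supercuspidal — [GelbartRogawski1991 §1.4, Lem. 5.1.2;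
GelbartRogawski1990 Prop. 5.2.2; HarrisKudlaSweet1996 Cor. 4.4]), a global non-norm `θ` at `v` (★ `exists_units_not_isNorm_of_nonsplit`, [Omeara1963 65:21, 71:19]), and weak
approximation with the real signs of admissibility and the square class of `θ·ε₀` at `v` (★ (WAᴸ-2)); `a·ε₀⁻¹ = θ·s²` is then a non-norm from `L ⊗ L⁺_v`.
[cite: Liu2021, Def. 4.12 (l. 2102–2108)] [cite: GelbartRogawski1991, §1.4 p. 451; Lem. 5.1.2 p. 466] [cite: Omeara1963, §65 Prop. 65:21] -/
theorem exists_admissibleLine_isSupercuspidal_xThetaCM (Φ : Set (L →+* ℂ)) (hΦ : ∀ φ ∈ Φ, ComplexEmbedding.conjugate φ ∉ Φ)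
    {δ : L} (hδ : IsCMField.complexConj L δ = -δ) (hδ0 : δ ≠ 0)
    (v : HeightOneSpectrum (𝓞 ↥(maximalRealSubfield L))) (hv : ∀ w : PlacesOver L v, IsCMField.complexConj L • w.1 = w.1) :
    ∃ a : (↥(maximalRealSubfield L))ˣ,
      IsAdmissibleElement L Φ (algebraMap ↥(maximalRealSubfield L) L a * δ) ∧ (xThetaCM L e₁ dV hdV hdV0 μ hμ χf a v).IsSupercuspidal := by
  -- the occurring class `ε₀` and a global non-norm `θ` at `v`
  obtain ⟨ε₀, hε₀⟩ := F0P3cDbTSupercuspidalOffOccurringClass.exists_line_forall_isSupercuspidal_xThetaCM_of_not_isNorm L e₁ dV hdV hdV0 μ hμ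
    χf hcont hunit v hv
  obtain ⟨θ, hθ⟩ := F0P2oK1occ.exists_units_not_isNorm_of_nonsplit L v hv
  -- an admissible line in the square class of `θ·ε₀` at `v`
  obtain ⟨a, s, hadm, has⟩ := Literature.AlgebraicGeometry.Liu2021.exists_isAdmissibleElement_algebraMap_mul_eq_mul_sq Φ hΦ hδ hδ0 v
    (Units.map (algebraMap ↥(maximalRealSubfield L) (v.adicCompletion ↥(maximalRealSubfield L))).toMonoidHom (θ * ε₀))
  refine ⟨a, hadm, hε₀ a ?_⟩
  rintro ⟨x, hx⟩
  apply hθ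
  -- `a = θ·ε₀·s²` in `L⁺_v`, hence `a·ε₀⁻¹ = θ·s²`
  have has' : algebraMap ↥(maximalRealSubfield L) (v.adicCompletion ↥(maximalRealSubfield L)) (a : ↥(maximalRealSubfield L)) =
      algebraMap ↥(maximalRealSubfield L) (v.adicCompletion ↥(maximalRealSubfield L)) (θ : ↥(maximalRealSubfield L)) *
        algebraMap ↥(maximalRealSubfield L) (v.adicCompletion ↥(maximalRealSubfield L)) (ε₀ : ↥(maximalRealSubfield L)) *
          (s : v.adicCompletion ↥(maximalRealSubfield L)) ^ 2 := by
    rw [has]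
    simp [Units.coe_map, map_mul]
  have hquot : algebraMap ↥(maximalRealSubfield L) (v.adicCompletion ↥(maximalRealSubfield L))
        (((a * ε₀⁻¹ : (↥(maximalRealSubfield L))ˣ) : ↥(maximalRealSubfield L))) =
      algebraMap ↥(maximalRealSubfield L) (v.adicCompletion ↥(maximalRealSubfield L)) (θ : ↥(maximalRealSubfield L)) *
        (s : v.adicCompletion ↥(maximalRealSubfield L)) ^ 2 := by
    have hε₀0 : algebraMap ↥(maximalRealSubfield L) (v.adicCompletion ↥(maximalRealSubfield L)) (ε₀ : ↥(maximalRealSubfield L)) ≠ 0 :=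
      (map_ne_zero _).2 ε₀.ne_zero
    rw [Units.val_mul, Units.val_inv_eq_inv_val, map_mul, map_inv₀, has']
    field_simp
  -- read in `L ⊗ L⁺_v` through `ι_v` (★ `toLocalRing_coe`)
  have key : ∀ y : ↥(maximalRealSubfield L),
      UnitaryGroup.toLocalRing L v (algebraMap ↥(maximalRealSubfield L) (v.adicCompletion ↥(maximalRealSubfield L)) y) =
        algebraMap L (UnitaryGroup.LocalRing L v) (y : L) := fun y => UnitaryGroup.toLocalRing_coe L v y
  have hsu : IsUnit (UnitaryGroup.toLocalRing L v (s : v.adicCompletion ↥(maximalRealSubfield L))) := (s.isUnit).map _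
  set u : (UnitaryGroup.LocalRing L v)ˣ := hsu.unit with hu_def
  have hu : (u : UnitaryGroup.LocalRing L v) = UnitaryGroup.toLocalRing L v (s : v.adicCompletion ↥(maximalRealSubfield L)) := hsu.unit_spec
  have hL : algebraMap L (UnitaryGroup.LocalRing L v) (((a * ε₀⁻¹ : (↥(maximalRealSubfield L))ˣ) : ↥(maximalRealSubfield L)) : L) =
      algebraMap L (UnitaryGroup.LocalRing L v) ((θ : ↥(maximalRealSubfield L)) : L) * ((u : UnitaryGroup.LocalRing L v) * u) := by
    rw [← key, hquot, map_mul, map_pow, key, hu, sq]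
  -- `ι_v s` is `σ`-fixed, hence so is its inverse
  have hcu : conjLocal L (IsCMField.complexConj L) v ((u⁻¹ : (UnitaryGroup.LocalRing L v)ˣ) : UnitaryGroup.LocalRing L v) =
      ((u⁻¹ : (UnitaryGroup.LocalRing L v)ˣ) : UnitaryGroup.LocalRing L v) := by
    apply Units.eq_inv_of_mul_eq_one_right
    have hfix : conjLocal L (IsCMField.complexConj L) v (u : UnitaryGroup.LocalRing L v) = u := by
      rw [hu, UnitaryGroup.conjLocal_toLocalRing]
    calc conjLocal L (IsCMField.complexConj L) v ((u⁻¹ : (UnitaryGroup.LocalRing L v)ˣ) : UnitaryGroup.LocalRing L v) * u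
        = conjLocal L (IsCMField.complexConj L) v ((u⁻¹ : (UnitaryGroup.LocalRing L v)ˣ) : UnitaryGroup.LocalRing L v) *
            conjLocal L (IsCMField.complexConj L) v (u : UnitaryGroup.LocalRing L v) := by rw [hfix]
      _ = 1 := by rw [← map_mul, Units.inv_mul, map_one]
  -- divide the norm equation by the unit `ι_v s`
  refine ⟨x * u⁻¹, ?_⟩
  rw [Units.val_mul, map_mul, hcu]
  calc (x : UnitaryGroup.LocalRing L v) * ((u⁻¹ : (UnitaryGroup.LocalRing L v)ˣ) : UnitaryGroup.LocalRing L v) *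
        (conjLocal L (IsCMField.complexConj L) v x * ((u⁻¹ : (UnitaryGroup.LocalRing L v)ˣ) : UnitaryGroup.LocalRing L v))
      = ((x : UnitaryGroup.LocalRing L v) * conjLocal L (IsCMField.complexConj L) v x) *
          (((u⁻¹ : (UnitaryGroup.LocalRing L v)ˣ) : UnitaryGroup.LocalRing L v) * ((u⁻¹ : (UnitaryGroup.LocalRing L v)ˣ) : UnitaryGroup.LocalRing L v)) := by
        ring
    _ = algebraMap L (UnitaryGroup.LocalRing L v) ((θ : ↥(maximalRealSubfield L)) : L) *
          (((u : UnitaryGroup.LocalRing L v) * ((u⁻¹ : (UnitaryGroup.LocalRing L v)ˣ) : UnitaryGroup.LocalRing L v)) *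
            ((u : UnitaryGroup.LocalRing L v) * ((u⁻¹ : (UnitaryGroup.LocalRing L v)ˣ) : UnitaryGroup.LocalRing L v))) := by
        rw [hx, hL]; ring
    _ = algebraMap L (UnitaryGroup.LocalRing L v) ((θ : ↥(maximalRealSubfield L)) : L) := by
        rw [Units.mul_inv, mul_one, mul_one]

end Line

/-! ## §2 Theta occurrence with a prescribed supercuspidal class, at a Rogawski frame, for weight-one `μ` and automorphic `χ` -/

section Occurrence

set_option synthInstance.maxHeartbeats 400000 in
set_option maxHeartbeats 16000000 in
/-- **THETA OCCURRENCE AT THE SUPERCUSPIDAL CLASS (Liu locus).**  At a Rogawski frame `(L, ι, H, T)` (signature `(2,1)` at `ι`, definite elsewhere, `[L⁺:ℚ] ≥ 2`) with a diagonal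
frame `(e₁, dV, g, ιV)` (`ιV k = g_f⁻¹ k g_f`), for every automorphic measure `μA`, every WEIGHT-ONE conjugate-symplectic `μ`, every automorphic `χ : Chi` and every non-split `v`:
there are a global line `a` and a DISCRETE automorphic `P ≤ L²(μA)` of `U(H)` with `P_f ↩ ω_H(μ, a, χ)` (★ `HasFinComponent (rhoAtLine … ιV a χ)`) such that `X_v(μ, a, χ.1)` is
SUPERCUSPIDAL.  §1 at `Φ := Φ_μ`, `δ := (2i)⁻¹` gives the `μ`-admissible line (★ `epsOf_algebraMap_mul`: `epsOf (a·δ) = locF a`); ★ OCC♭∀ (`stubOccFlatAll_of_thetaOccursInGen` ∘ ★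
Θ-OCC-GEN `thetaOccursInGen`) gives `P`. [cite: GelbartRogawski1991, §3.4 Prop. 3.4.1 pp. 459–460, Thm. 3.4 (a) p. 461; Lem. 5.1.2 p. 466]
[cite: Liu2021, Prop. 4.13 (l. 2145–2149); Def. 4.12 (l. 2102–2108); App. D Lem. D.1 (1)] -/
theorem exists_hasFinComponent_isSupercuspidal_liuLocus
    (L : Type) [Field L] [NumberField L] [IsCMField L] (ι : L →+* ℂ) (H : Matrix (Fin 3) (Fin 3) L) (T : GL (Fin 3) ℂ)
    (hT : (T : Matrix (Fin 3) (Fin 3) ℂ)ᴴ * H.map ι * (T : Matrix (Fin 3) (Fin 3) ℂ) = Literature.Geometry.ComplexHyperbolic.BallModel.J)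
    (hdef : ∀ τ' : L →+* ℂ, InfinitePlace.mk τ' ≠ InfinitePlace.mk ι → (H.map τ').PosDef) (h2 : 2 ≤ Module.finrank ℚ ↥(maximalRealSubfield L))
    {n' : ℕ} (e₁ : Fin 3 × Fin 1 ≃ Fin n') (dV : Fin 3 → L) (hdV : ∀ i, IsCMField.complexConj L (dV i) = dV i)
    (hdV0 : ∀ i, dV i ≠ 0) (g : GL (Fin 3) L)
    (hg : ((g : Matrix (Fin 3) (Fin 3) L).map (cmConjRingHom L))ᵀ * H * (g : Matrix (Fin 3) (Fin 3) L) = Matrix.diagonal dV)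
    (ιV : finAdelic (↥(maximalRealSubfield L)) L (IsCMField.complexConj L) 3 H →*
      finAdelic (↥(maximalRealSubfield L)) L (IsCMField.complexConj L) 3 (Matrix.diagonal dV))
    (hιV : ∀ k, ((ιV k : finAdelic (↥(maximalRealSubfield L)) L (IsCMField.complexConj L) 3 (Matrix.diagonal dV)) :
      GL (Fin 3) (FiniteAdeleRing (𝓞 L) L)) =
      (toFinAdeleGL L 3 g)⁻¹ * (k : GL (Fin 3) (FiniteAdeleRing (𝓞 L) L)) * toFinAdeleGL L 3 g)
    (μA : Measure (adelicGroupData (↥(maximalRealSubfield L)) L (IsCMField.complexConj L) 3 H).automorphicQuotient)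
    [(adelicGroupData (↥(maximalRealSubfield L)) L (IsCMField.complexConj L) 3 H).IsAutomorphicMeasure μA]
    (μ : Literature.NumberTheory.Automorphic.IdeleClassGroup L →ₜ* Circle) (hμ : IsConjugateSymplectic L μ) (hw : HasWeight L μ 1)
    (χ : Chi (↥(maximalRealSubfield L)) L (IsCMField.complexConj L))
    (v : HeightOneSpectrum (𝓞 ↥(maximalRealSubfield L))) (hv : ∀ w : PlacesOver L v, IsCMField.complexConj L • w.1 = w.1) :
    ∃ a : (↥(maximalRealSubfield L))ˣ,
      (∃ P : DiscreteAutomorphicRep (adelicGroupData (↥(maximalRealSubfield L)) L (IsCMField.complexConj L) 3 H) μA,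
        P.HasFinComponent
          (rhoAtLine (↥(maximalRealSubfield L)) L (IsCMField.complexConj L) 3 e₁ (Matrix.diagonal dV)
            (complexConj_imagUnit L) (imagUnit_ne_zero L) (imagUnit_mul_self L) (realDiagonal_isSymm L dV hdV)
            (isUnit_det_realDiagonal L dV hdV hdV0) (realDiagonal_map L dV hdV).symm
            (fun a => isCompatible_chiSplittingLine L e₁ dV hdV hdV0 (toHeckeCharacter L μ)
              (isUnitary_toHeckeCharacter L μ) ((isOscillatorChar_toHeckeCharacter_iff μ).mpr hμ)
              (TW (↥(maximalRealSubfield L)) a) (isSymm_TW (↥(maximalRealSubfield L)) a)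
              (isUnit_det_TW (↥(maximalRealSubfield L)) a) (JW (↥(maximalRealSubfield L)) L a)
              (JW_eq (↥(maximalRealSubfield L)) L a)) ιV a χ)) ∧
      (xThetaCM L e₁ dV hdV hdV0 μ hμ χ.1 a v).IsSupercuspidal := by
  haveI : Algebra.IsQuadraticExtension ↥(maximalRealSubfield L) L := IsCMField.isQuadraticExtension L
  -- `δ := (2i)⁻¹` is purely imaginary and non-zero
  have hδ0 : ((2 : L) * imagUnit L)⁻¹ ≠ 0 := inv_ne_zero (mul_ne_zero two_ne_zero (imagUnit_ne_zero L))
  have hδ : IsCMField.complexConj L (((2 : L) * imagUnit L)⁻¹) = -((2 : L) * imagUnit L)⁻¹ := by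
    rw [map_inv₀, map_mul, map_ofNat, complexConj_imagUnit, mul_neg, inv_neg]
  obtain ⟨a, hadm, hsc⟩ := exists_admissibleLine_isSupercuspidal_xThetaCM L e₁ dV hdV hdV0 μ hμ χ.1 χ.2.1 (Def411WeilCarriers.norm_chi_eq_one_cm L χ)
    hμ.cmType.1 (fun φ hφ => (hμ.cmType.2 φ).mp hφ) hδ hδ0 v hv
  have hadm' : ∃ e : L, IsAdmissibleElement L hμ.cmType.1 e ∧
      epsOf (↥(maximalRealSubfield L)) (imagUnitSq L) L (2 * imagUnit L)⁻¹ e = locF (↥(maximalRealSubfield L)) (imagUnitSq L) a :=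
    ⟨_, hadm, epsOf_algebraMap_mul (↥(maximalRealSubfield L)) (imagUnitSq L) L ((2 : L) * imagUnit L)⁻¹ hδ0 a⟩
  obtain ⟨P, -, hfin⟩ := F0P2sOccFlatAllOfThetaOccursIn.stubOccFlatAll_of_thetaOccursInGen F0P2tThetaOccursInGenNeg.thetaOccursInGen
    L ι H T hT hdef h2 e₁ dV hdV hdV0 g hg ιV hιV μA μ hμ hw a χ hadm'
  exact ⟨a, ⟨P, hfin⟩, hsc⟩

end Occurrence

/-! ## §3 DICT1∕DICT2 ⇒ the two GLOBAL pins, for an automorphic `χ` -/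

section Pins

variable (L : Type) [Field L] [NumberField L] [IsCMField L]

set_option synthInstance.maxHeartbeats 400000 in
set_option maxHeartbeats 8000000 in
/-- **THE GLOBAL DICTIONARY PINS FROM THEIR FINITE SHAPES, for an automorphic `χ`.**  DICT1 (`μ̃_v = (η̃⁻¹ψ̃⁻¹μω)_v` semilocally at every finite `v`) gives `μ̃ = η̃⁻¹ψ̃⁻¹μω`
(★ `HeckeCharacter.eq_of_forall_semilocalComponent_eq`: `L^× · 𝔸_{L,f}^×` is dense in `𝕀_L`); DICT2 (`χ_f(z∕z̄) = (ψ̃⁻¹(η̃⁻¹ψ̃⁻¹μω)²)((1_∞, z))` for finite idèle units `z`) gives, for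
`χ : Chi` with `χ.1 = χ_f`, `χ̌ = ψ̃⁻¹(η̃⁻¹ψ̃⁻¹μω)²` (both sides agree on every local unit `(1, single_w u)`, ★ `localComponent_checkOfChi_apply`, ★ `ext_of_forall_localComponent_eq`).
[cite: Liu2021, App. D §D.1 (l. 5224)] [cite: CasselsFrohlichANT1967, Ch. VII Prop. 4.1] [cite: Rogawski1990, §12.2 (2) p. 174; §13.1 p. 199] -/
theorem globalPins_of_dict (ξ : OneDimAutRepH L) (μω : HeckeCharacter L)
    (μ : Literature.NumberTheory.Automorphic.IdeleClassGroup L →ₜ* Circle)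
    (χ : Chi (↥(maximalRealSubfield L)) L (IsCMField.complexConj L))
    (hD1 : ∀ v : HeightOneSpectrum (𝓞 ↥(maximalRealSubfield L)),
      (toHeckeCharacter L μ).semilocalComponent L v = (ξ.bcη⁻¹ * ξ.bcψ⁻¹ * μω).semilocalComponent L v)
    (hD2 : ∀ z : (FiniteAdeleRing (𝓞 L) L)ˣ,
      χ.1 (finAdelicCheck (↥(maximalRealSubfield L)) L (IsCMField.complexConj L)
          (AlgEquiv.ext fun x => by rw [AlgEquiv.mul_apply, IsCMField.complexConj_apply_apply, AlgEquiv.one_apply]) z) =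
        (ξ.bcψ⁻¹ * (ξ.bcη⁻¹ * ξ.bcψ⁻¹ * μω) ^ 2)
          (Units.map (N := AdeleRing (𝓞 L) L) (MonoidHom.inr (InfiniteAdeleRing L) (FiniteAdeleRing (𝓞 L) L)) z)) :
    toHeckeCharacter L μ = ξ.bcη⁻¹ * ξ.bcψ⁻¹ * μω ∧
      HeckeCharacter.checkOfChi (Def411WeilCarriers.complexConj_mul_complexConj' L) χ = ξ.bcψ⁻¹ * (ξ.bcη⁻¹ * ξ.bcψ⁻¹ * μω) ^ 2 := by
  refine ⟨HeckeCharacter.eq_of_forall_semilocalComponent_eq L hD1,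
    Literature.NumberTheory.GaloisRepresentations.HeckeCharacter.ext_of_forall_localComponent_eq fun w u => ?_⟩
  rw [localComponent_checkOfChi_apply, HeckeCharacter.localComponent_apply]
  exact hD2 (Units.map (finiteAdeleSingle w) u)

end Pins

/-! ## §4 The conclusion of (O1) `StubThetaLiftMember` ON THE LIU LOCUS -/

section O1

set_option synthInstance.maxHeartbeats 400000 in
set_option maxHeartbeats 16000000 in
/-- **(O1) «GLOBAL THETA MEMBER WITH PRESCRIBED NON-SPLIT CLASS» HOLDS ON THE LIU LOCUS, hypothesis-free there.**  For the (O1) binders of the LH10 leaf (CM `(L, H)`, Rogawski's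
`μω`, a rational theta frame `(e₁, dV, g)`, `ξ`, a DICT-tied `(μ, χ_f)`, a non-split `v`) PLUS: a Rogawski frame `(ι, T)` of `H` (`hT`, definite off `ι`, `[L⁺:ℚ] ≥ 2`), an
automorphic measure `μA`, `HasWeight L μ 1`, and an automorphic `χ : Chi` with `χ.1 = χ_f` — there are a global line `ε` and a discrete automorphic `P ≤ L²(μA)` in the
ξ-local family (★ `MemXiFamily`) having a `v`-constituent, all of whose `v`-constituents are SUPERCUSPIDAL of theta type `X_v(μ, ε, χ_f) ∘ κ_v⁻¹`: §2 (occurrence + class), §3 (global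
pins), ★ S2♯-θ `memXiFamily_of_theta_of_clauses` over ★ FILE 2, ★ (TCᴸ) `exists_and_forall_isConstituentOf_theta` (the (O1-RED) peel's engine; `ιV := g_f⁻¹ · g_f`, ★ `finAdelicCongr`).
This is the organ's conclusion TOKEN FOR TOKEN after its `∃ (μA) (_ : IsAutomorphicMeasure μA)` is instantiated at the given `μA`.
[cite: GelbartRogawski1991, §3.4 Prop. 3.4.1 pp. 459–460, Thm. 3.4 (a) p. 461; §5.1 (5.1.1) p. 465, Lem. 5.1.2 p. 466] [cite: Rogawski1990, §13.1 Prop. 13.1.3 (d) p. 199; §14.6 pp. 242–245]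
[cite: Liu2021, Def. 4.11 (l. 2090–2096); Prop. 4.13 (l. 2145–2149); App. D §D.1 (l. 5224), Lem. D.1 (1)] -/
theorem stubThetaLiftMember_liuLocus
    (L : Type) [Field L] [NumberField L] [IsCMField L] (ι : L →+* ℂ) (H : Matrix (Fin 3) (Fin 3) L) (T : GL (Fin 3) ℂ)
    (hT : (T : Matrix (Fin 3) (Fin 3) ℂ)ᴴ * H.map ι * (T : Matrix (Fin 3) (Fin 3) ℂ) = Literature.Geometry.ComplexHyperbolic.BallModel.J)
    (hdef : ∀ τ' : L →+* ℂ, InfinitePlace.mk τ' ≠ InfinitePlace.mk ι → (H.map τ').PosDef) (h2 : 2 ≤ Module.finrank ℚ ↥(maximalRealSubfield L))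
    (hH : (H.map (cmConjRingHom L))ᵀ = H) (hHd : IsUnit H.det) (μω : HeckeCharacter L) (hμu : μω.IsUnitary)
    (hμω : ∀ x : Literature.NumberTheory.GaloisRepresentations.ideleGroup ↥(maximalRealSubfield L),
      μω (AdeleRing.ideleBaseChange (↥(maximalRealSubfield L)) L x) = quadraticHeckeCharCM L x)
    {n' : ℕ} (e₁ : Fin 3 × Fin 1 ≃ Fin n') (dV : Fin 3 → L) (hdV : ∀ i, IsCMField.complexConj L (dV i) = dV i) (hdV0 : ∀ i, dV i ≠ 0)
    (g : GL (Fin 3) L) (hg : ((g : Matrix (Fin 3) (Fin 3) L).map (cmConjRingHom L))ᵀ * H * (g : Matrix (Fin 3) (Fin 3) L) = Matrix.diagonal dV)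
    (ξ : OneDimAutRepH L)
    (μ : Literature.NumberTheory.Automorphic.IdeleClassGroup L →ₜ* Circle) (hμ : IsConjugateSymplectic L μ)
    (χf : UnitaryGroup.finAdelicOne (↥(maximalRealSubfield L)) L (IsCMField.complexConj L) →* ℂˣ)
    (hD1 : ∀ v : HeightOneSpectrum (𝓞 ↥(maximalRealSubfield L)),
      (toHeckeCharacter L μ).semilocalComponent L v = (ξ.bcη⁻¹ * ξ.bcψ⁻¹ * μω).semilocalComponent L v)
    (hD2 : ∀ z : (FiniteAdeleRing (𝓞 L) L)ˣ,
      χf (finAdelicCheck (↥(maximalRealSubfield L)) L (IsCMField.complexConj L)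
          (AlgEquiv.ext fun x => by rw [AlgEquiv.mul_apply, IsCMField.complexConj_apply_apply, AlgEquiv.one_apply]) z) =
        (ξ.bcψ⁻¹ * (ξ.bcη⁻¹ * ξ.bcψ⁻¹ * μω) ^ 2)
          (Units.map (N := AdeleRing (𝓞 L) L) (MonoidHom.inr (InfiniteAdeleRing L) (FiniteAdeleRing (𝓞 L) L)) z))
    -- the LIU LOCUS
    (μA : Measure (adelicGroupData (↥(maximalRealSubfield L)) L (IsCMField.complexConj L) 3 H).automorphicQuotient)
    [hμA : (adelicGroupData (↥(maximalRealSubfield L)) L (IsCMField.complexConj L) 3 H).IsAutomorphicMeasure μA]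
    (hw : HasWeight L μ 1) (χ : Chi (↥(maximalRealSubfield L)) L (IsCMField.complexConj L)) (hχ : χ.1 = χf)
    (v : HeightOneSpectrum (𝓞 ↥(maximalRealSubfield L))) (hv : ∀ w : PlacesOver L v, IsCMField.complexConj L • w.1 = w.1) :
    ∃ (ε : (↥(maximalRealSubfield L))ˣ)
      (μA : Measure (adelicGroupData (↥(maximalRealSubfield L)) L (IsCMField.complexConj L) 3 H).automorphicQuotient)
      (_ : (adelicGroupData (↥(maximalRealSubfield L)) L (IsCMField.complexConj L) 3 H).IsAutomorphicMeasure μA)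
      (P : DiscreteAutomorphicRep (adelicGroupData (↥(maximalRealSubfield L)) L (IsCMField.complexConj L) 3 H) μA),
      MemXiFamily P hH hHd μω hμu ξ ∧
      (∃ c : IrrClass ((cmDatum L 3 H).Local v),
        (IrrClass.comap (localPiEquiv L (IsCMField.complexConj L) 3 H v) c).IsConstituentOf
          (P.finRep.smoothPart.toRepresentation.comp (inclPlace (↥(maximalRealSubfield L)) L (IsCMField.complexConj L) 3 H v))) ∧
      ∀ c : IrrClass ((cmDatum L 3 H).Local v),
        (IrrClass.comap (localPiEquiv L (IsCMField.complexConj L) 3 H v) c).IsConstituentOf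
            (P.finRep.smoothPart.toRepresentation.comp (inclPlace (↥(maximalRealSubfield L)) L (IsCMField.complexConj L) 3 H v)) →
          c.IsSupercuspidal ∧ ThetaTypeAtCM L H e₁ dV hdV hdV0 g hg μ hμ χf ε v c := by
  subst hχ
  -- the frame transport `ιV := g_f⁻¹ · g_f`
  let ιV : finAdelic (↥(maximalRealSubfield L)) L (IsCMField.complexConj L) 3 H →*
      finAdelic (↥(maximalRealSubfield L)) L (IsCMField.complexConj L) 3 (Matrix.diagonal dV) :=
    ((UnitaryGroup.finAdelicCongr (↥(maximalRealSubfield L)) L (IsCMField.complexConj L) g one_ne_zero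
      (show formCongr (IsCMField.complexConj L : L →+* L) g ((1 : L) • H) = Matrix.diagonal dV by rw [one_smul]; exact hg)).symm :
        _ ≃ₜ* _).toMonoidHom
  have hιV : ∀ k, ((ιV k : finAdelic (↥(maximalRealSubfield L)) L (IsCMField.complexConj L) 3 (Matrix.diagonal dV)) :
      GL (Fin 3) (FiniteAdeleRing (𝓞 L) L)) =
      (toFinAdeleGL L 3 g)⁻¹ * (k : GL (Fin 3) (FiniteAdeleRing (𝓞 L) L)) * toFinAdeleGL L 3 g := fun k => rfl
  obtain ⟨a, ⟨P, hfin⟩, hsc⟩ := exists_hasFinComponent_isSupercuspidal_liuLocus L ι H T hT hdef h2 e₁ dV hdV hdV0 g hg ιV hιV μA μ hμ hw χ v hv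
  obtain ⟨hμξ, hχξ⟩ := globalPins_of_dict L ξ μω μ χ hD1 hD2
  refine ⟨a, μA, hμA, P, ?_, F0P3cDbTThetaConstituents.exists_and_forall_isConstituentOf_theta L H e₁ dV hdV hdV0 g hg ιV hιV
    μA P μ hμ a χ hfin v hsc⟩
  exact F0P2uS2SharpTheta.memXiFamily_of_theta_of_clauses L H hH hHd e₁ dV hdV hdV0 g hg ιV hιV μA P ξ μω hμu μ hμ a χ
    (Def411WeilCarriers.complexConj_mul_complexConj' L) hμξ hχξ hfin
    (fun w hw' => F0P2uMemXiFamilyThetaNonsplit.nonsplit_clause_of_hasFinComponent_theta L H hH hHd e₁ dV hdV hdV0 g hg ιV hιV μA P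
      μω hμu hμω μ hμ a χ hfin ξ (Def411WeilCarriers.complexConj_mul_complexConj' L) hμξ hχξ w hw')


set_option synthInstance.maxHeartbeats 400000 in
set_option maxHeartbeats 16000000 in
/-- **(O1) ON THE LIU LOCUS, MEASURE-FREE (ED. 2)**: the conclusion of `StubThetaLiftMember` for the (O1) binders plus the Rogawski frame, `HasWeight L μ 1` and an automorphic
`χ : Chi` with `χ.1 = χ_f` — the automorphic measure is now PRODUCED from the frame (`H` is anisotropic there, ★ `F0P3ClassTokensOfRecord.anisotropic_of_frame`; ★
`UnitaryGroup.exists_isAutomorphicMeasure_adelicGroupData`, [Borel1963 §5]) and fed to `stubThetaLiftMember_liuLocus`.  This is the closer of the ROAD-W organ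
`StubThetaLiftMemberW1` (the W1 wrapper takes `χ := ⟨χ_f, haut⟩`, `hχ := rfl`).
[cite: GelbartRogawski1991, §3.4 Prop. 3.4.1 pp. 459–460, Thm. 3.4 (a) p. 461; Lem. 5.1.2 p. 466] [cite: Borel1963, §5] [cite: Liu2021, Prop. 4.13 (l. 2145–2149); App. D Lem. D.1 (1)] -/
theorem stubThetaLiftMember_liuLocus'
    (L : Type) [Field L] [NumberField L] [IsCMField L] (ι : L →+* ℂ) (H : Matrix (Fin 3) (Fin 3) L) (T : GL (Fin 3) ℂ)
    (hT : (T : Matrix (Fin 3) (Fin 3) ℂ)ᴴ * H.map ι * (T : Matrix (Fin 3) (Fin 3) ℂ) = Literature.Geometry.ComplexHyperbolic.BallModel.J)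
    (hdef : ∀ τ' : L →+* ℂ, InfinitePlace.mk τ' ≠ InfinitePlace.mk ι → (H.map τ').PosDef) (h2 : 2 ≤ Module.finrank ℚ ↥(maximalRealSubfield L))
    (hH : (H.map (cmConjRingHom L))ᵀ = H) (hHd : IsUnit H.det) (μω : HeckeCharacter L) (hμu : μω.IsUnitary)
    (hμω : ∀ x : Literature.NumberTheory.GaloisRepresentations.ideleGroup ↥(maximalRealSubfield L),
      μω (AdeleRing.ideleBaseChange (↥(maximalRealSubfield L)) L x) = quadraticHeckeCharCM L x)
    {n' : ℕ} (e₁ : Fin 3 × Fin 1 ≃ Fin n') (dV : Fin 3 → L) (hdV : ∀ i, IsCMField.complexConj L (dV i) = dV i) (hdV0 : ∀ i, dV i ≠ 0)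
    (g : GL (Fin 3) L) (hg : ((g : Matrix (Fin 3) (Fin 3) L).map (cmConjRingHom L))ᵀ * H * (g : Matrix (Fin 3) (Fin 3) L) = Matrix.diagonal dV)
    (ξ : OneDimAutRepH L)
    (μ : Literature.NumberTheory.Automorphic.IdeleClassGroup L →ₜ* Circle) (hμ : IsConjugateSymplectic L μ)
    (χf : UnitaryGroup.finAdelicOne (↥(maximalRealSubfield L)) L (IsCMField.complexConj L) →* ℂˣ)
    (hD1 : ∀ v : HeightOneSpectrum (𝓞 ↥(maximalRealSubfield L)),
      (toHeckeCharacter L μ).semilocalComponent L v = (ξ.bcη⁻¹ * ξ.bcψ⁻¹ * μω).semilocalComponent L v)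
    (hD2 : ∀ z : (FiniteAdeleRing (𝓞 L) L)ˣ,
      χf (finAdelicCheck (↥(maximalRealSubfield L)) L (IsCMField.complexConj L)
          (AlgEquiv.ext fun x => by rw [AlgEquiv.mul_apply, IsCMField.complexConj_apply_apply, AlgEquiv.one_apply]) z) =
        (ξ.bcψ⁻¹ * (ξ.bcη⁻¹ * ξ.bcψ⁻¹ * μω) ^ 2)
          (Units.map (N := AdeleRing (𝓞 L) L) (MonoidHom.inr (InfiniteAdeleRing L) (FiniteAdeleRing (𝓞 L) L)) z))
    -- the LIU LOCUS (measure-free)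
    (hw : HasWeight L μ 1) (χ : Chi (↥(maximalRealSubfield L)) L (IsCMField.complexConj L)) (hχ : χ.1 = χf)
    (v : HeightOneSpectrum (𝓞 ↥(maximalRealSubfield L))) (hv : ∀ w : PlacesOver L v, IsCMField.complexConj L • w.1 = w.1) :
    ∃ (ε : (↥(maximalRealSubfield L))ˣ)
      (μA : Measure (adelicGroupData (↥(maximalRealSubfield L)) L (IsCMField.complexConj L) 3 H).automorphicQuotient)
      (_ : (adelicGroupData (↥(maximalRealSubfield L)) L (IsCMField.complexConj L) 3 H).IsAutomorphicMeasure μA)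
      (P : DiscreteAutomorphicRep (adelicGroupData (↥(maximalRealSubfield L)) L (IsCMField.complexConj L) 3 H) μA),
      MemXiFamily P hH hHd μω hμu ξ ∧
      (∃ c : IrrClass ((cmDatum L 3 H).Local v),
        (IrrClass.comap (localPiEquiv L (IsCMField.complexConj L) 3 H v) c).IsConstituentOf
          (P.finRep.smoothPart.toRepresentation.comp (inclPlace (↥(maximalRealSubfield L)) L (IsCMField.complexConj L) 3 H v))) ∧
      ∀ c : IrrClass ((cmDatum L 3 H).Local v),
        (IrrClass.comap (localPiEquiv L (IsCMField.complexConj L) 3 H v) c).IsConstituentOf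
            (P.finRep.smoothPart.toRepresentation.comp (inclPlace (↥(maximalRealSubfield L)) L (IsCMField.complexConj L) 3 H v)) →
          c.IsSupercuspidal ∧ ThetaTypeAtCM L H e₁ dV hdV hdV0 g hg μ hμ χf ε v c := by
  obtain ⟨μA, hμA⟩ := UnitaryGroup.exists_isAutomorphicMeasure_adelicGroupData L 3 H
    (F0P3ClassTokensOfRecord.anisotropic_of_frame L H ι hdef h2)
  haveI := hμA
  exact stubThetaLiftMember_liuLocus L ι H T hT hdef h2 hH hHd μω hμu hμω e₁ dV hdV hdV0 g hg ξ μ hμ χf hD1 hD2 μA hw χ hχ v hv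

end O1

end Summit.HodgeConjecture.HodgeConjecture.Cruxes.H413.F0P3cDbTThetaOccurrenceLiuLocus

end
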